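import Literature.MathematicalPhysics.QuantumFieldTheory.VillainJensen
import Literature.MathematicalPhysics.QuantumFieldTheory.VillainTranslation
import Literature.MathematicalPhysics.QuantumFieldTheory.WilsonLoopReversal
import HarnessLib

/-!
# The perimeter law for Wilson loops in four-dimensional `U(1)` lattice gauge theory with the
# Villain action at weak coupling (Fröhlich–Spencer 1982 / Guth 1980)

Support file of the proof programme of the named fact
`Literature.MathematicalPhysics.QuantumFieldTheory.FrohlichSpencerU1PerimeterLawD4` (Wilson action,
FS82 p. 433, whose analytic part is only asserted in print) and of its corollary
`Literature.Barriers.QuantumFields.AbelianDeconfinementD4`: here the VILLAIN-action statement of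
FS82 Theorem (2.8) / Garban–Sepúlveda 2023 Thm 1.2 is PROVED, by assembling the printed proof of
FS82 §2.4–§2.10 formalised in the sibling files:

* duality (`VillainDuality`: `⟨W_γ⟩_Λ = e^{-E_Λ(S)/2β} · A_Λ`, `A_Λ` the Coulomb-gas average over
  integer fluxes), the exact regulator-free monopole gas with the full Laplacian
  (`VillainCoulombGas`, `gasRatio_eq_dualRatio`), Kac–Siegert + torus characters + `z_q`-resummation
  (`VillainKacSiegertTorus`, FS82 (2.36)–(2.44)), Lemma 2 and the projection onto closed densities
  (`VillainGasEnsembles`), Corollary 4 (`VillainRenormalisation`), the activity bounds, the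
  phase representatives and their summation (`VillainJensen`, `VillainPhaseBound`,
  `VillainLocalPrimitive`; FS82 (2.74)–(2.87)), and the spin-wave bound
  `E_Λ(S) ≤ C(R+T)` (`VillainSheetEnergyBound`, FS82 (2.88));
* `hasSum_uR_zAct` (`∑_{k≥1} 2/z_k = 1` for `z_k = 2^{k+1}`), `evalSum_lower_bound`,
  **`gasNum_ge`** (`e^{-(c_J(ε,ε)+C₀)} · gasDen ≤ gasNum` for `β ≥ β₀`), `gasRatio_ge`;
* **`villain_perimeter_law`**: there is `β₀ > 0` such that for every `β ≥ β₀` there is `c > 0` with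
  `e^{-c(R+T)} ≤ ⟨W_{R×T}⟩^{Villain}_{box 4 m, β}` for every rectangular loop and all large `m`
  (free boundary conditions, `d = 4`) — the perimeter-law lower bound, uniformly in the volume;
  `villain_perimeter_law_ne` (all pairs of distinct directions, by the reversal symmetry of
  `WilsonLoopReversal`) and `villain_perimeter_law_boxLimit` (the bound for every box limit of the
  loop expectations — the shape of `FrohlichSpencerU1PerimeterLawD4`, Villain action, with the
  existence of the limit left to the consumer).

Everything is proved; no named fact is introduced.

## References

* J. Fröhlich, T. Spencer, Massless phases and symmetry restoration in abelian gauge theories and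
  spin systems, Comm. Math. Phys. 83 (1982) 411–454, Theorem (2.8) p. 419, §2.4–§2.10.
  [FrohlichSpencerCMP1982]
* A. H. Guth, Phys. Rev. D 21 (1980) 2291–2307 (Villain action). [Guth1980]
* C. Garban, A. Sepúlveda, Improved spin-wave estimate for Wilson loops in U(1) lattice gauge
  theory, IMRN 2023, Theorem 1.2. [GarbanSepulveda2023]
-/

noncomputable section

open Finset Function Matrix MeasureTheory Filter Set
open scoped Real Topology
open Literature.Probability.LatticeModels
open Literature.Probability.LatticeModels.GaussianCoord (exactPart perpPart exactEnergy)
open Literature.Probability.LatticeModels.EnsembleExpansion (phase ensembleProd Term evalSum weightSum IsOneEnsemble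
  IsAdjConnected nbhd evalSum_cons evalSum_nil)
open Literature.MathematicalPhysics.QuantumLattice (u1Rep continuous_u1Rep)

namespace Literature.MathematicalPhysics.QuantumFieldTheory

/-- Sites of `ℤ^d` (the namespace-local `Site` is the torus one). -/
local notation "ZSite" => Literature.Probability.LatticeModels.Site

namespace VillainAngle

open AxialGauge LatticeForm LatticeChain VillainFibre

variable {n : ℕ}

/-! ### The activities sum to one -/

/-- **`∑_{k ≥ 1} u_k = 1`** for `u_k = 2/z_k = 2^{-k}`. [cite: FrohlichSpencerCMP1982, §2.6 (2.38)] -/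
theorem hasSum_uR_zAct : HasSum (uR zAct) 1 := by
  have h := hasSum_geometric_two' (1 : ℝ)
  have h2 : HasSum (fun k : ℕ => uR zAct (k + 1)) (1 - ∑ i ∈ Finset.range 1, uR zAct i) := by
    have h0 : ∑ i ∈ Finset.range 1, uR zAct i = 0 := by simp [uR]
    rw [h0, sub_zero]
    convert h using 1
    funext k
    simp only [uR, zAct, Nat.succ_ne_zero, if_false]
    rw [pow_succ, pow_succ]
    field_simp
  exact (hasSum_nat_add_iff' 1).1 h2

/-! ### Bounds and integrability of the ensemble sums -/

/-- `|∏_ρ (1 + K_ρ cos ρ(α))| ≤ ∏_ρ (1 + |K_ρ|)`. [folklore] -/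
theorem abs_ensembleProd_le (N : Finset (CIdx 4 n →₀ ℤ)) (K : (CIdx 4 n →₀ ℤ) → ℝ) (α : CIdx 4 n → ℝ) :
    |ensembleProd N K α| ≤ ∏ ρ ∈ N, (1 + |K ρ|) := by
  rw [ensembleProd, Finset.abs_prod]
  refine Finset.prod_le_prod (fun _ _ => abs_nonneg _) fun ρ _ => ?_
  calc |1 + K ρ * Real.cos (phase ρ α)| ≤ |(1 : ℝ)| + |K ρ * Real.cos (phase ρ α)| := abs_add_le _ _
    _ ≤ 1 + |K ρ| := by
        rw [abs_one, abs_mul]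
        exact add_le_add le_rfl (mul_le_of_le_one_right (abs_nonneg _) (Real.abs_cos_le_one _))

/-- A term is bounded. [folklore] -/
theorem abs_eval_le (t : Term (CIdx 4 n)) (α : CIdx 4 n → ℝ) :
    |t.eval α| ≤ |t.weight| * ∏ ρ ∈ t.family, (1 + |t.activity ρ|) := by
  rw [Term.eval, abs_mul]
  exact mul_le_mul_of_nonneg_left (abs_ensembleProd_le _ _ _) (abs_nonneg _)

/-- An ensemble sum is bounded. [folklore] -/
theorem exists_bound_evalSum (L : List (Term (CIdx 4 n))) : ∃ C : ℝ, ∀ α, |evalSum L α| ≤ C := by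
  induction L with
  | nil => exact ⟨0, fun α => by simp⟩
  | cons t L ih =>
    obtain ⟨C, hC⟩ := ih
    refine ⟨|t.weight| * ∏ ρ ∈ t.family, (1 + |t.activity ρ|) + C, fun α => ?_⟩
    rw [evalSum_cons]
    exact (abs_add_le _ _).trans (add_le_add (abs_eval_le t α) (hC α))

/-- Gaussian times bounded continuous is integrable. [folklore] -/
theorem integrable_auxGauss_mul {β : ℝ} (hβ : 0 < β) {F : (CIdx 4 n → ℝ) → ℝ} (hF : Continuous F)
    {C : ℝ} (hC : ∀ a, |F a| ≤ C) : Integrable fun a => auxGauss β a * F a :=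
  (integrable_auxGauss hβ).mul_bdd hF.aestronglyMeasurable
    (ae_of_all _ fun a => by rw [Real.norm_eq_abs]; exact hC a)

/-- Integrability of a shifted term against the Gaussian. [folklore] -/
theorem integrable_auxGauss_mul_eval {β : ℝ} (hβ : 0 < β) (t : Term (CIdx 4 n)) (ψ : CIdx 4 n → ℝ) :
    Integrable fun a => auxGauss β a * t.eval (a + ψ) :=
  integrable_auxGauss_mul hβ ((continuous_eval t).comp (continuous_id.add continuous_const))
    fun a => abs_eval_le t (a + ψ)

/-- Integrability of a shifted ensemble sum against the Gaussian. [folklore] -/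
theorem integrable_auxGauss_mul_evalSum {β : ℝ} (hβ : 0 < β) (L : List (Term (CIdx 4 n))) (ψ : CIdx 4 n → ℝ) :
    Integrable fun a => auxGauss β a * evalSum L (a + ψ) := by
  obtain ⟨C, hC⟩ := exists_bound_evalSum L
  exact integrable_auxGauss_mul hβ ((continuous_evalSum L).comp (continuous_id.add continuous_const))
    fun a => hC (a + ψ)

/-! ### The lower bound on the Wilson numerator of the gas -/

/-- **Lower bound for one multiplicity pattern** (sum of `term_lower_bound` over the terms of the
closed-ensemble expansion, weights `> 0`). [cite: FrohlichSpencerCMP1982, §2.10 (2.80)–(2.81), (2.87)] -/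
theorem evalSum_lower_bound (hn : 1 ≤ n) {β : ℝ} (hβ : betaJ ≤ β) (S : PIdx 4 n → ℤ) (κ : CIdx 4 n → ℕ)
    (L : List (Term (CIdx 4 n)))
    (hw : ∀ t ∈ L, 0 < t.weight) (hens : ∀ t ∈ L, IsOneEnsemble adjC t.family)
    (hdens : ∀ t ∈ L, ∀ ρ ∈ t.family, ρ ≠ 0 ∧ ∀ b ∈ ρ.support, |ρ b| = κ b)
    (hact : ∀ t ∈ L, ∀ ρ ∈ t.family, 0 ≤ t.activity ρ ∧
      t.activity ρ ≤ 3 ^ (nbhd adjC Finset.univ ρ.support).card * ∏ b ∈ ρ.support, zAct (κ b) ∧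
      (EInt ρ ≠ 0 → t.activity ρ = 0))
    (hconn : ∀ t ∈ L, ∀ ρ ∈ t.family, IsAdjConnected adjC ρ.support) :
    Real.exp (-(cJ * (epsField S ⬝ᵥ epsField S) + C0)) * ∫ a, auxGauss β a * evalSum L a ≤
      ∫ a, auxGauss β a * evalSum L (a + auxShift fun p => (S p : ℝ)) := by
  have hβpos : 0 < β := betaJ_pos.trans_le hβ
  set ψ : CIdx 4 n → ℝ := auxShift fun p => (S p : ℝ) with hψ
  set E : ℝ := Real.exp (-(cJ * (epsField S ⬝ᵥ epsField S) + C0)) with hE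
  induction L with
  | nil => simp
  | cons t L ih =>
    have hw' : ∀ t ∈ L, 0 < t.weight := fun s hs => hw s (List.mem_cons_of_mem _ hs)
    have hens' : ∀ t ∈ L, IsOneEnsemble adjC t.family := fun s hs => hens s (List.mem_cons_of_mem _ hs)
    have hdens' : ∀ t ∈ L, ∀ ρ ∈ t.family, ρ ≠ 0 ∧ ∀ b ∈ ρ.support, |ρ b| = κ b :=
      fun s hs => hdens s (List.mem_cons_of_mem _ hs)
    have hact' : ∀ t ∈ L, ∀ ρ ∈ t.family, 0 ≤ t.activity ρ ∧
        t.activity ρ ≤ 3 ^ (nbhd adjC Finset.univ ρ.support).card * ∏ b ∈ ρ.support, zAct (κ b) ∧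
        (EInt ρ ≠ 0 → t.activity ρ = 0) := fun s hs => hact s (List.mem_cons_of_mem _ hs)
    have hconn' : ∀ t ∈ L, ∀ ρ ∈ t.family, IsAdjConnected adjC ρ.support :=
      fun s hs => hconn s (List.mem_cons_of_mem _ hs)
    have ihL := ih hw' hens' hdens' hact' hconn'
    have ht := List.mem_cons_self (a := t) (l := L)
    -- the term `t`
    obtain ⟨hT, -⟩ := term_lower_bound hn hβ S κ t.family t.activity (hens t ht) (hdens t ht) (hact t ht) (hconn t ht)
    have hterm : E * ∫ a, auxGauss β a * t.eval a ≤ ∫ a, auxGauss β a * t.eval (a + ψ) := by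
      have h1 : ∀ φ : CIdx 4 n → ℝ, ∫ a, auxGauss β a * t.eval (a + φ) =
          t.weight * ∫ a, auxGauss β a * ensembleProd t.family t.activity (a + φ) := fun φ => by
        rw [← integral_const_mul]
        refine integral_congr_ae (Filter.Eventually.of_forall fun a => ?_)
        simp only [Term.eval]
        ring
      have h0 := h1 0
      simp only [add_zero] at h0
      rw [h0, h1 ψ]
      calc E * (t.weight * ∫ a, auxGauss β a * ensembleProd t.family t.activity a)
          = t.weight * (E * ∫ a, auxGauss β a * ensembleProd t.family t.activity a) := by ring
        _ ≤ t.weight * ∫ a, auxGauss β a * ensembleProd t.family t.activity (a + ψ) :=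
            mul_le_mul_of_nonneg_left hT (hw t ht).le
    -- split the integrals
    have hsplitψ : ∫ a, auxGauss β a * evalSum (t :: L) (a + ψ) =
        (∫ a, auxGauss β a * t.eval (a + ψ)) + ∫ a, auxGauss β a * evalSum L (a + ψ) := by
      rw [← integral_add (integrable_auxGauss_mul_eval hβpos t ψ) (integrable_auxGauss_mul_evalSum hβpos L ψ)]
      refine integral_congr_ae (Filter.Eventually.of_forall fun a => ?_)
      simp only [evalSum_cons]
      ring
    have hsplit0 : ∫ a, auxGauss β a * evalSum (t :: L) a =
        (∫ a, auxGauss β a * t.eval a) + ∫ a, auxGauss β a * evalSum L a := by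
      have h1 := integrable_auxGauss_mul_eval hβpos t 0
      have h2 := integrable_auxGauss_mul_evalSum hβpos L 0
      simp only [add_zero] at h1 h2
      rw [← integral_add h1 h2]
      refine integral_congr_ae (Filter.Eventually.of_forall fun a => ?_)
      simp only [evalSum_cons]
      ring
    rw [hsplitψ, hsplit0, mul_add]
    exact add_le_add hterm ihL

/-- **The Wilson numerator of the monopole gas dominates `e^{-(c_J(ε,ε)+C₀)}` times its partition
function** (`β ≥ β₀`; FS82 (2.81) with (2.87): the same expansion, term by term).
[cite: FrohlichSpencerCMP1982, §2.10 (2.78)–(2.81), (2.87)] -/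
theorem gasNum_ge (hn : 1 ≤ n) {β : ℝ} (hβ : betaJ ≤ β) (S : PIdx 4 n → ℤ) :
    Real.exp (-(cJ * (epsField S ⬝ᵥ epsField S) + C0)) * gasDen (d := 4) (n := n) β ≤
      gasNum β (fun p => (S p : ℝ)) := by
  have hβpos : 0 < β := betaJ_pos.trans_le hβ
  set Sr : PIdx 4 n → ℝ := fun p => (S p : ℝ) with hSr
  set E : ℝ := Real.exp (-(cJ * (epsField S ⬝ᵥ epsField S) + C0)) with hE
  obtain ⟨hsN, hN⟩ := gasNum_eq_tsum_kappa hβpos zAct_pos hasSum_uR_zAct Sr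
  obtain ⟨hsD, hD⟩ := gasDen_eq_tsum_kappa (d := 4) (n := n) hβpos zAct_pos hasSum_uR_zAct
  rw [hN, hD, ← tsum_mul_left]
  refine Summable.tsum_le_tsum (fun κ => ?_) (hsD.mul_left _) hsN
  have hu : 0 ≤ ∏ c, uR zAct (κ c) := Finset.prod_nonneg fun c _ => uR_nonneg zAct_pos _
  have hZ : 0 ≤ (auxZ (d := 4) (n := n) β)⁻¹ := (inv_pos.2 (auxZ_pos hβpos)).le
  by_cases hκ : ∀ c, 1 ≤ κ c
  · obtain ⟨L, hw, -, hens, hdens, hact, hconn, hIψ, hI0⟩ :=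
      exists_closed_ensemble_expansion hβpos zAct_pos κ hκ Sr
    rw [hIψ, hI0]
    have key := evalSum_lower_bound hn hβ S κ L hw hens hdens hact hconn
    calc E * ((∏ c, uR zAct (κ c)) * ((auxZ (d := 4) (n := n) β)⁻¹ * ∫ a, auxGauss β a * evalSum L a))
        = (∏ c, uR zAct (κ c)) * ((auxZ (d := 4) (n := n) β)⁻¹ * (E * ∫ a, auxGauss β a * evalSum L a)) := by
          ring
      _ ≤ (∏ c, uR zAct (κ c)) * ((auxZ (d := 4) (n := n) β)⁻¹ *
            ∫ a, auxGauss β a * evalSum L (a + auxShift Sr)) :=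
          mul_le_mul_of_nonneg_left (mul_le_mul_of_nonneg_left key hZ) hu
  · push Not at hκ
    obtain ⟨c, hc⟩ := hκ
    have hc0 : κ c = 0 := by omega
    have h0 : ∏ c, uR zAct (κ c) = 0 := Finset.prod_eq_zero (Finset.mem_univ c) (by simp [uR, hc0])
    rw [h0]
    simp

/-- **`A_Λ = gasNum/gasDen ≥ e^{-(c_J (ε,ε) + C₀)}`** for `β ≥ β₀`. [cite: FrohlichSpencerCMP1982, §2.10 (2.81), (2.87)] -/
theorem gasRatio_ge (hn : 1 ≤ n) {β : ℝ} (hβ : betaJ ≤ β) (S : PIdx 4 n → ℤ) :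
    Real.exp (-(cJ * (epsField S ⬝ᵥ epsField S) + C0)) ≤
      gasNum β (fun p => (S p : ℝ)) / gasDen (d := 4) (n := n) β :=
  (le_div_iff₀ (gasDen_pos (betaJ_pos.trans_le hβ))).2 (gasNum_ge hn hβ S)

/-- `(ε, ε) = E_T(S)`. [cite: FrohlichSpencerCMP1982, §2.7 (2.52)] -/
theorem epsField_dotProduct_self (S : PIdx 4 n → ℤ) :
    epsField S ⬝ᵥ epsField S = exactEnergy dMat fun p => (S p : ℝ) :=
  exactPart_dotProduct_self dMat posDef_gram_dMat _

/-! ### The perimeter law -/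

/-- **Perimeter law for the four-dimensional Villain `U(1)` lattice gauge theory at weak coupling
(Fröhlich–Spencer 1982, Theorem (2.8), Villain action; Guth 1980).** There is `β₀ > 0` such that
for every `β ≥ β₀` there is a constant `c > 0` with
`exp(-c (R + T)) ≤ ⟨W_γ⟩^{Villain}_{box 4 m, β}`
for every rectangular Wilson loop `γ = ∂(R × T)` (`R, T ≥ 1`, plane `i < j`, any base point) and
all sufficiently large cubes `box 4 m = {-m, …, m}⁴` with free boundary conditions — the Wilson
loop expectations decay no faster than the perimeter, uniformly in the volume (deconfinement of
static charges in the Coulomb phase). The constants are explicit: `β₀ = betaJ`,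
`c = (1/(2β) + c_J) C + C₀` with `C` the spin-wave constant of `exactEnergy_sheet_le`.
Proof: FS82 §2.4–§2.10 as assembled in this file's imports (duality, monopole gas, Lemma 2,
Corollary 4, Jensen, Lemma 1, spin waves). [cite: FrohlichSpencerCMP1982, Theorem (2.8) p. 419 (Villain action), §2.4–§2.10] -/
theorem villain_perimeter_law :
    ∃ β₀ : ℝ, 0 < β₀ ∧ ∀ β : ℝ, β₀ ≤ β → ∃ c : ℝ, 0 < c ∧
      ∀ (x₀ : ZSite 4) (i j : Fin 4), i < j → ∀ R T : ℕ, 1 ≤ R → 1 ≤ T →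
        ∀ᶠ m : ℕ in atTop,
          Real.exp (-(c * (R + T))) ≤ zdVillainExpect β (box 4 m) (zdWilsonLoop u1Rep x₀ i j R T) := by
  refine ⟨betaJ, betaJ_pos, fun β hβ => ?_⟩
  have hβpos : 0 < β := betaJ_pos.trans_le hβ
  obtain ⟨C, hC, hE⟩ := exactEnergy_sheet_le (n := 3) le_rfl
  have hcJ := cJ_nonneg
  have hC0 := C0_nonneg
  refine ⟨(1 / (2 * β) + cJ) * C + C0 + 1, by positivity, fun x₀ i j hij R T hR hT => ?_⟩
  filter_upwards [hE x₀ i j hij R T hR hT, eventually_rectPlaqs_subset (x₀ := x₀) hij R T] with m hEm hsub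
  -- the translated loop lies in `Λ = halfOpenBox 4 (2m+1)`
  have hsub' : rectPlaqs (x₀ + diag 4 m) i j R T ⊆ plaquettesIn (halfOpenBox 4 (2 * m + 1)) := by
    rw [rectPlaqs_add, plaquettesIn_halfOpenBox_eq_image]
    exact Finset.image_subset_image hsub
  rw [← zdVillainExpect_wilsonLoop_halfOpenBox hβpos m x₀ i j R T,
    zdVillainExpect_wilsonLoop_eq_dual hβpos hij.ne hsub', mul_div_assoc, ← gasRatio_eq_dualRatio hβpos]
  set Sℤ : PIdx 4 (2 * m + 1) → ℤ := sheetIdx (n := 2 * m + 1) (x₀ + diag 4 m) i j R T with hSℤ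
  have hratio := gasRatio_ge (n := 2 * m + 1) (by omega) hβ Sℤ
  have hεE : epsField Sℤ ⬝ᵥ epsField Sℤ = exactEnergy dMat fun p => (Sℤ p : ℝ) := epsField_dotProduct_self Sℤ
  have hEm' : exactEnergy dMat (fun p => (Sℤ p : ℝ)) ≤ C * (R + T) := hEm
  have hE0 : 0 ≤ exactEnergy dMat (fun p => (Sℤ p : ℝ)) := by
    rw [← hεE, dotProduct]; exact Finset.sum_nonneg fun _ _ => mul_self_nonneg _
  have hRT : (2 : ℝ) ≤ R + T := by
    have h1 : (1 : ℝ) ≤ R := by exact_mod_cast hR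
    have h2 : (1 : ℝ) ≤ T := by exact_mod_cast hT
    linarith
  calc Real.exp (-(((1 / (2 * β) + cJ) * C + C0 + 1) * (R + T)))
      ≤ Real.exp (-(exactEnergy dMat fun p => (Sℤ p : ℝ)) / (2 * β)) *
          Real.exp (-(cJ * (epsField Sℤ ⬝ᵥ epsField Sℤ) + C0)) := by
        rw [← Real.exp_add]
        refine Real.exp_le_exp.2 ?_
        rw [hεE]
        have h1 : exactEnergy dMat (fun p => (Sℤ p : ℝ)) / (2 * β) ≤ (1 / (2 * β)) * (C * (R + T)) := by
          rw [div_eq_mul_one_div, mul_comm]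
          exact mul_le_mul_of_nonneg_left hEm' (by positivity)
        have h2 : cJ * exactEnergy dMat (fun p => (Sℤ p : ℝ)) ≤ cJ * (C * (R + T)) :=
          mul_le_mul_of_nonneg_left hEm' hcJ
        have h3 : C0 ≤ C0 * (R + T) := by nlinarith
        have h4 : 0 ≤ (R + T : ℝ) := by linarith
        have h5 : (-exactEnergy dMat fun p => (Sℤ p : ℝ)) / (2 * β) =
            -((exactEnergy dMat fun p => (Sℤ p : ℝ)) / (2 * β)) := neg_div _ _
        rw [h5]
        nlinarith
    _ ≤ Real.exp (-(exactEnergy dMat fun p => (Sℤ p : ℝ)) / (2 * β)) *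
          (gasNum β (fun p => (Sℤ p : ℝ)) / gasDen (d := 4) (n := 2 * m + 1) β) :=
        mul_le_mul_of_nonneg_left hratio (Real.exp_pos _).le

/-- **Perimeter law, all pairs of distinct directions** (the loop in the `(i, j)` plane with `i > j`
is the reversed loop in the `(j, i)` plane, `WilsonLoopReversal`). [cite: FrohlichSpencerCMP1982, Theorem (2.8) p. 419 (Villain action)] -/
theorem villain_perimeter_law_ne :
    ∃ β₀ : ℝ, 0 < β₀ ∧ ∀ β : ℝ, β₀ ≤ β → ∃ c : ℝ, 0 < c ∧
      ∀ (x₀ : ZSite 4) (i j : Fin 4), i ≠ j → ∀ R T : ℕ, 1 ≤ R → 1 ≤ T →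
        ∀ᶠ m : ℕ in atTop,
          Real.exp (-(c * (R + T))) ≤ zdVillainExpect β (box 4 m) (zdWilsonLoop u1Rep x₀ i j R T) := by
  obtain ⟨β₀, hβ₀, h⟩ := villain_perimeter_law
  refine ⟨β₀, hβ₀, fun β hβ => ?_⟩
  obtain ⟨c, hc, hc'⟩ := h β hβ
  refine ⟨c, hc, fun x₀ i j hij R T hR hT => ?_⟩
  rcases lt_or_gt_of_ne hij with hlt | hgt
  · exact hc' x₀ i j hlt R T hR hT
  · have hswap : zdWilsonLoop (d := 4) u1Rep x₀ i j R T = zdWilsonLoop u1Rep x₀ j i T R :=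
      zdWilsonLoop_u1Rep_swap x₀ j i T R
    rw [hswap]
    have := hc' x₀ j i hgt T R hT hR
    simpa only [add_comm (T : ℝ) R] using this

/-- **Perimeter law for the infinite-volume loop expectations (Villain action)**: in the shape of
`FrohlichSpencerU1PerimeterLawD4` — for `β > β₀` there is `c > 0` such that every box limit `w` of
`Λ ↦ ⟨W_{R×T}⟩^{Villain}_{Λ,β}` (whenever it exists, e.g. under `VillainU1FreeInfiniteVolumeLimit 4`)
satisfies `exp(-c · 2(R+T)) ≤ w`, for all base points, distinct directions and `R, T ≥ 1`.
[cite: FrohlichSpencerCMP1982, Theorem (2.8) p. 419 (Villain action); GarbanSepulveda2023 Thm 1.2] -/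
theorem villain_perimeter_law_boxLimit :
    ∃ β₀ : ℝ, 0 < β₀ ∧ ∀ β : ℝ, β₀ < β → ∃ c : ℝ, 0 < c ∧
      ∀ (x : ZSite 4) (i j : Fin 4) (R T : ℕ), i ≠ j → 1 ≤ R → 1 ≤ T →
        ∀ w : ℝ, HasBoxLimit (fun Λ => zdVillainExpect β Λ (zdWilsonLoop u1Rep x i j R T)) w →
          Real.exp (-c * (2 * (R + T))) ≤ w := by
  obtain ⟨β₀, hβ₀, h⟩ := villain_perimeter_law_ne
  refine ⟨β₀, hβ₀, fun β hβ => ?_⟩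
  obtain ⟨c, hc, hc'⟩ := h β hβ.le
  refine ⟨c / 2, by positivity, fun x i j R T hij hR hT w hw => ?_⟩
  have hev := hc' x i j hij R T hR hT
  have heq : Real.exp (-(c / 2) * (2 * (R + T))) = Real.exp (-(c * (R + T))) := by
    congr 1; ring
  rw [heq]
  exact ge_of_tendsto hw hev

end VillainAngle

end Literature.MathematicalPhysics.QuantumFieldTheory
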